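import Literature.AnabelianGeometry.AbsoluteAnabelian.MLFReciprocityCyclotomicNorm
import Literature.AnabelianGeometry.AbsoluteAnabelian.AbsAnabUnitsTransportIntegers
import Literature.AnabelianGeometry.AbsoluteAnabelian.AbsAnabUnitsTransportLevelwise
import Literature.AnabelianGeometry.AbsoluteAnabelian.AbsAnabUnitsTransportHolds
import Literature.AnabelianGeometry.AbsoluteAnabelian.MLFGaloisGroupsHolds
import Literature.AnabelianGeometry.AbsoluteAnabelian.MonoidKummerMapsTLGLiftTransport
import Literature.AnabelianGeometry.AbsoluteAnabelian.GaloisPadicLogPowers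
import Literature.NumberTheory.PAdicHodge.PadicBaseField
import HarnessLib

/-!
# THE Galois-equivariant lift of `φ ∈ Aut_top(G_k)` preserves `N_{k/ℚ_p}` on `𝒪_k^×` (standard closure)

Proof-only file (abc-iut cell, layer L4 / LCFT lane; GAP-LEDGER row G-L6d2-1 «`MLFClosure.norm_liftM_eq`»,
STAGE 2 of abc-iut-w6-d012's plan).  S. Mochizuki, *Inter-universal Teichmüller theory II*, §1, Remark 1.8.1,
kurims manuscript p. 42 l. 1–6 («… a natural surjection `O^{×μ}(G) ↠ ℚ_p`, which [cf. [AbsAnab], Proposition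
1.2.1, (vi)] is `Aut(G)`-equivariant»), with S. Mochizuki, *The Absolute Anabelian Geometry of Hyperbolic Curves*
(2004), Prop. 1.2.1 (iii)/(vi)/(vii) pp. 10–11, and J.-P. Serre, *Local class field theory* (Cassels–Fröhlich
Ch. VI) §3.1 Thm. 2 / §2.4.

`MLFClosure.norm_liftM_eq_std`: for an MLF `k` (characteristic `0`) with its STANDARD closure `k̄ = AlgebraicClosure k`,
a prime `p` with `|p|_k < 1` (canonical `ℚ_p`-algebra structure), a topological automorphism `φ` of `G_k` and a unit
`u ∈ 𝒪_k^×`: if THE `φ`-equivariant lift `liftM(φ)` of abc-iut-L6-t13's genuine `AbsTopMonoids` producer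
(`AbsTopMonoids.Genuine.liftM ⟨k, k̄⟩ φ`, [AbsTopIII] Prop. 3.2 (iv)) carries `u` to `u' ∈ k`, then
`N_{k/ℚ_p}(u') = N_{k/ℚ_p}(u)`.  Assembly, all BY NAME: `liftM = ψ̄` on `𝒪_k̄^⊳` for THE units transport `ψ̄`
of [AbsAnab] Prop. 1.2.1 row L02 (`Prop121vii.unitsTransport_holds`, `liftM_coe_eq_of_unitsTransport`); `ψ̄` IS the
reciprocity transport at the bottom level `E₁ = E₂ = k` (`Prop121vii.levelwise_of_isAlphaEquivariant`:
`Art (ψ̄ u) = [φ h]` whenever `Art u = [h]`, `Art` from `exists_reciprocity_characterized_embField k k`);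
`χ_p ∘ Art = N⁻¹` on units (STAGE 1, `cyclotomicCharacter_eq_norm_inv_of_art_eq`); and `χ_p ∘ φ = χ_p`
([AbsAnab] Prop. 1.2.1 (vi), `galoisMLF_iso_cyclotomicChar_holds`).  STAGE 3, same file: the transport to an
ARBITRARY algebraic closure `C : MLFClosure` — `MLFClosure.algEquiv_coe_liftM` (THE lift of `C`, read through
`IsAlgClosure.equiv : C.K ≃ₐ[k] AlgebraicClosure k`, is THE lift of the standard closure for the conjugated
automorphism, by `Genuine.liftM_unique`) — and **`MLFClosure.norm_liftM_eq`**, the GAP-LEDGER row G-L6d2-1 VERBATIM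
(the binder `hN` of abc-iut-L6-d2's `AbsTopMonoids.rmk181_genuineOfModelIsm_of_normCompat`).

Classical local class field theory; theorems only, no definitions, no named facts; universe `0`.
HONEST FRAMING: nothing here bears on [IUTchIII] Cor. 3.12; no side taken.
-/

noncomputable section

open Field IsNonarchimedeanLocalField ValuativeRel
open scoped Pointwise

namespace Literature.AnabelianGeometry.AbsoluteAnabelian

open Literature.NumberTheory.GaloisRepresentations
open Literature.NumberTheory.GaloisRepresentations.LocalWeilDatum
open AbstractCFT AbstractCFT.WeilDatum

/-- **THE lift preserves the norm on base units (standard closure).**  For an MLF `k` of characteristic `0`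
with `k̄ = AlgebraicClosure k`, a prime `p` with `|p|_k < 1`, `φ ∈ Aut_top(G_k)`, `u ∈ 𝒪_k^×` and `u' ∈ k` with
`liftM(φ)(u) = u'`: `N_{k/ℚ_p}(u') = N_{k/ℚ_p}(u)` ([IUTchII] Rmk. 1.8.1 p. 42 «`Aut(G)`-equivariant», via
[AbsAnab] Prop. 1.2.1 (iii)/(vi) and `χ_cyc ∘ Art_k = N_{k/ℚ_p}⁻¹`).
[cite: MochizukiAbsAnab2004, Prop 1.2.1 (vi) p.10] -/
theorem MLFClosure.norm_liftM_eq_std (K : Type) [Field K] [ValuativeRel K] [TopologicalSpace K]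
    [IsNonarchimedeanLocalField K] [CharZero K] (p : ℕ) [Fact p.Prime] (hp : valuation K p < 1)
    (φ : absoluteGaloisGroup K ≃ₜ* absoluteGaloisGroup K) (u u' : K)
    (hu : algebraMap K (AlgebraicClosure K) u ∈ nonzeroIntegers K (AlgebraicClosure K))
    (hv : valuation K u = 1)
    (heq : ((Literature.IUT.HodgeArakelov.AbsTopMonoids.Genuine.liftM
        ({ k := K, K := AlgebraicClosure K } : MLFClosure.{0}) φ ⟨algebraMap K (AlgebraicClosure K) u, hu⟩ :
          (ModelMLFGaloisData.galois K (AlgebraicClosure K)).tmPair.M) : AlgebraicClosure K) =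
        algebraMap K (AlgebraicClosure K) u') :
    letI := LocalField.padicAlgebra K p hp
    Algebra.norm ℚ_[p] u' = Algebra.norm ℚ_[p] u := by
  letI := LocalField.padicAlgebra K p hp
  haveI : FiniteDimensional ℚ_[p] K :=
    Literature.NumberTheory.PAdicHodge.PadicBase.instFiniteDimensional (F := K) hp
  have hu0 : u ≠ 0 := by
    intro h0
    rw [h0, map_zero] at hv
    exact zero_ne_one hv
  -- (1) THE units transport `ψ̄` of row L02 and `liftM = ψ̄` on `𝒪^⊳`
  obtain ⟨ψ, hψ, hU, hπ⟩ := Prop121vii.unitsTransport_holds K K φ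
  have hlift := Prop121vii.liftM_coe_eq_of_unitsTransport hψ hU hπ ⟨algebraMap K (AlgebraicClosure K) u, hu⟩
  rw [hlift] at heq
  -- `heq : (ψ (Units.mk0 (ι u) _) : k̄) = ι u'`
  -- (2) the bottom level `E₁ = E₂ = k`
  haveI : ValuativeExtension K K := ⟨fun _ _ => Iff.rfl⟩
  have hN₀ : ∀ g : absoluteGaloisGroup K,
      g ∈ galFixing K (embField K K) ↔ φ g ∈ galFixing K (embField K K) := fun g =>
    ⟨fun _ => mem_galFixing_embField_self _, fun _ => mem_galFixing_embField_self _⟩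
  let u₀ : (embField K K)ˣ := Units.map (equivEmbField K K : K →* embField K K) (Units.mk0 u hu0)
  have hsymm : Units.map ((equivEmbField K K).symm : embField K K →* K) u₀ = Units.mk0 u hu0 := by
    ext
    simp [u₀]
  have hunit : Units.map ((equivEmbField K K).symm : embField K K →* K) u₀ ∈
      (valuation K).valuationSubring.unitGroup := by
    rw [hsymm, Valuation.mem_unitGroup_iff]
    exact hv
  let x : (AlgebraicClosure K)ˣ :=
    Units.mk0 (algebraMap K (AlgebraicClosure K) u) ((map_ne_zero _).mpr hu0)
  have hx : (x : AlgebraicClosure K) = ((u₀ : embField K K) : AlgebraicClosure K) := by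
    rw [coe_embField_self]
    change algebraMap K (AlgebraicClosure K) u =
      algebraMap K (AlgebraicClosure K) ((equivEmbField K K).symm (equivEmbField K K u))
    rw [AlgEquiv.symm_apply_apply]
  -- (3) `ψ̄` is the reciprocity transport at the bottom level
  obtain ⟨v, hvx, hvunit, -, hArt⟩ :=
    Prop121vii.levelwise_of_isAlphaEquivariant φ hψ hπ K K hN₀ u₀ x hx
  -- (4) THE reciprocity map of `(k, k)`, characterised by `recSystemE`
  obtain ⟨Art, -, -, -, hchar, -⟩ := exists_reciprocity_characterized_embField K K
  obtain ⟨h, hh⟩ := QuotientGroup.mk_surjective (Art u₀)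
  have hArt₂ := hArt hchar hchar h hh.symm
  -- (5) `χ_p ∘ Art = N⁻¹` at `u₀` and at `v = ψ̄ u₀`
  have e₁ := cyclotomicCharacter_eq_norm_inv_of_art_eq K K p hp hchar hunit hh.symm
  have hvunit' : Units.map ((equivEmbField K K).symm : embField K K →* K) v ∈
      (valuation K).valuationSubring.unitGroup := hvunit.mp hunit
  have e₂ := cyclotomicCharacter_eq_norm_inv_of_art_eq K K p hp hchar hvunit' hArt₂
  -- (6) `χ_p (φ h) = χ_p h` ([AbsAnab] Prop. 1.2.1 (vi))
  have e₃ : GaloisRep.cyclotomicCharacter K p (φ (h : absoluteGaloisGroup K)) =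
      GaloisRep.cyclotomicCharacter K p (h : absoluteGaloisGroup K) :=
    galoisMLF_iso_cyclotomicChar_holds p p K K φ p (h : absoluteGaloisGroup K)
  -- (7) `ι⁻¹ v = u'`
  have hv' : (equivEmbField K K).symm (v : embField K K) = u' := by
    apply (algebraMap K (AlgebraicClosure K)).injective
    rw [← coe_embField_self, ← hvx]
    exact heq
  -- assemble
  have e₂' : (((GaloisRep.cyclotomicCharacter K p (φ (h : absoluteGaloisGroup K)) : ℤ_[p]ˣ) : ℤ_[p]) : ℚ_[p]) =
      (Algebra.norm ℚ_[p] u')⁻¹ := by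
    rw [← hv']
    exact e₂
  rw [e₃, e₁, hsymm] at e₂'
  exact (inv_injective e₂').symm

/-! ### STAGE 3: an arbitrary algebraic closure -/

section AnyClosure

open Literature.NumberTheory.GaloisRepresentations (algEquivContinuousMulEquivAbsoluteGaloisGroup)

/-- A `k`-isomorphism of closures carries `𝒪^⊳` onto `𝒪^⊳` (integrality over `𝒪_k` and non-vanishing are transported).
[cite: MochizukiAbsTopIII2015, Definition 3.1 (i) p.66] -/
theorem MLFClosure.mem_nonzeroIntegers_algEquiv_iff (C : MLFClosure.{0}) {K' : Type} [Field K'] [Algebra C.k K']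
    (e : C.K ≃ₐ[C.k] K') (x : C.K) : e x ∈ nonzeroIntegers C.k K' ↔ x ∈ nonzeroIntegers C.k C.K := by
  change e x ∈ integersClosure C.k K' ∧ e x ≠ 0 ↔ x ∈ integersClosure C.k C.K ∧ x ≠ 0
  rw [mem_integersClosure_algEquiv_iff, map_ne_zero_iff _ e.injective]

/-- **THE lift is independent of the algebraic closure**: for `C : MLFClosure`, `ψ := IsAlgClosure.equiv : C.K ≃ₐ[k]
AlgebraicClosure k`, `e : Gal(C.K/k) ≃ₜ* Γ_k` the induced identification of Galois groups
(`algEquivContinuousMulEquivAbsoluteGaloisGroup`, conjugation by `ψ`) and `φ ∈ Aut_top(Gal(C.K/k))`: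
`ψ (liftM_C(φ) z) = liftM_{⟨k, k̄⟩}(e ∘ φ ∘ e⁻¹) (ψ z)` on `𝒪^⊳` — the conjugate of the standard lift is
`φ`-equivariant, so it IS the lift of `C` (`Genuine.liftM_unique`). [cite: MochizukiAbsTopIII2015, Proposition 3.2 (iv) p.72] -/
theorem MLFClosure.algEquiv_coe_liftM (C : MLFClosure.{0})
    (φ : (ModelMLFGaloisData.galois C.k C.K).tmPair.Pi ≃ₜ* (ModelMLFGaloisData.galois C.k C.K).tmPair.Pi)
    (z : nonzeroIntegers C.k C.K) :
    IsAlgClosure.equiv C.k C.K (AlgebraicClosure C.k)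
        ((Literature.IUT.HodgeArakelov.AbsTopMonoids.Genuine.liftM C φ z : nonzeroIntegers C.k C.K) : C.K) =
      ((Literature.IUT.HodgeArakelov.AbsTopMonoids.Genuine.liftM
          ({ k := C.k, K := AlgebraicClosure C.k } : MLFClosure.{0})
          ((algEquivContinuousMulEquivAbsoluteGaloisGroup C.k C.K).symm.trans
            (φ.trans (algEquivContinuousMulEquivAbsoluteGaloisGroup C.k C.K)))
          ⟨IsAlgClosure.equiv C.k C.K (AlgebraicClosure C.k) (z : C.K),
            (C.mem_nonzeroIntegers_algEquiv_iff _ _).mpr z.2⟩ :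
          nonzeroIntegers C.k (AlgebraicClosure C.k)) : AlgebraicClosure C.k) := by
  -- notation
  let ψ : C.K ≃ₐ[C.k] AlgebraicClosure C.k := IsAlgClosure.equiv C.k C.K (AlgebraicClosure C.k)
  let e := algEquivContinuousMulEquivAbsoluteGaloisGroup C.k C.K
  let φ₀ : absoluteGaloisGroup C.k ≃ₜ* absoluteGaloisGroup C.k := e.symm.trans (φ.trans e)
  let C₀ : MLFClosure.{0} := { k := C.k, K := AlgebraicClosure C.k }
  let Λ := Literature.IUT.HodgeArakelov.AbsTopMonoids.Genuine.liftM C₀ φ₀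
  -- `𝒪^⊳_{C.K} ≃ 𝒪^⊳_{k̄}` along `ψ`
  let toStd : nonzeroIntegers C.k C.K ≃* nonzeroIntegers C.k (AlgebraicClosure C.k) :=
    { toFun := fun x => ⟨ψ (x : C.K), (C.mem_nonzeroIntegers_algEquiv_iff ψ _).mpr x.2⟩
      invFun := fun y => ⟨ψ.symm (y : AlgebraicClosure C.k),
        (C.mem_nonzeroIntegers_algEquiv_iff ψ _).mp (by rw [AlgEquiv.apply_symm_apply]; exact y.2)⟩
      left_inv := fun x => Subtype.ext (ψ.symm_apply_apply _)
      right_inv := fun y => Subtype.ext (ψ.apply_symm_apply _)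
      map_mul' := fun x y => Subtype.ext (by simp) }
  have htoStd : ∀ x : nonzeroIntegers C.k C.K, ((toStd x : nonzeroIntegers C.k (AlgebraicClosure C.k)) :
      AlgebraicClosure C.k) = ψ (x : C.K) := fun _ => rfl
  have htoStd_symm : ∀ y : nonzeroIntegers C.k (AlgebraicClosure C.k),
      ((toStd.symm y : nonzeroIntegers C.k C.K) : C.K) = ψ.symm (y : AlgebraicClosure C.k) := fun _ => rfl
  -- the conjugated lift
  let Λ' : nonzeroIntegers C.k C.K ≃* nonzeroIntegers C.k C.K := toStd.trans (Λ.trans toStd.symm)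
  -- the action of the standard model pair, as a function with the pair's binder types
  let smulStd : (ModelMLFGaloisData.galois C.k (AlgebraicClosure C.k)).tmPair.Pi →
      (ModelMLFGaloisData.galois C.k (AlgebraicClosure C.k)).tmPair.M →
      (ModelMLFGaloisData.galois C.k (AlgebraicClosure C.k)).tmPair.M := fun τ w => τ • w
  have hΛ' : ∀ (σ : (ModelMLFGaloisData.galois C.k C.K).tmPair.Pi) (x : (ModelMLFGaloisData.galois C.k C.K).tmPair.M),
      Λ' (σ • x) = φ σ • Λ' x := by
    intro σ x
    -- `toStd (σ • x) = (e σ) • toStd x` in the standard model pair (`e σ` acts as `ψ ∘ σ ∘ ψ⁻¹`)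
    have h1 : toStd (σ • x) = smulStd (e σ) (toStd x) := by
      apply Subtype.ext
      show ψ (((σ • x : (ModelMLFGaloisData.galois C.k C.K).tmPair.M)) : C.K) =
        ψ ((ModelMLFGaloisData.galois C.k C.K).aug σ (ψ.symm (ψ (x : C.K))))
      rw [AlgEquiv.symm_apply_apply]
      rfl
    -- `liftM_spec` of the standard lift, transported through `h1`
    have h3 : Λ (toStd (σ • x)) = smulStd (φ₀ (e σ)) (Λ (toStd x)) := by
      rw [h1]
      exact Literature.IUT.HodgeArakelov.AbsTopMonoids.Genuine.liftM_spec C₀ φ₀ (e σ) (toStd x)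
    apply Subtype.ext
    rw [ModelMLFGaloisData.nonzeroIntegers_coe_smul]
    show ψ.symm ((Λ (toStd (σ • x)) : nonzeroIntegers C.k (AlgebraicClosure C.k)) : AlgebraicClosure C.k) = _
    rw [h3]
    -- `φ₀ (e σ) = e (φ (e⁻¹ (e σ)))` acts on `k̄` as `ψ ∘ φ(σ) ∘ ψ⁻¹`
    show ψ.symm (ψ ((ModelMLFGaloisData.galois C.k C.K).aug (φ (e.symm (e σ)))
        (ψ.symm ((Λ (toStd x) : nonzeroIntegers C.k (AlgebraicClosure C.k)) : AlgebraicClosure C.k)))) = _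
    rw [AlgEquiv.symm_apply_apply, ContinuousMulEquiv.symm_apply_apply e σ]
    rfl
  have hΛ'eq : Λ' = Literature.IUT.HodgeArakelov.AbsTopMonoids.Genuine.liftM C φ :=
    Literature.IUT.HodgeArakelov.AbsTopMonoids.Genuine.liftM_unique C φ Λ' hΛ'
  -- conclude
  rw [← hΛ'eq]
  change ψ (((toStd.symm (Λ (toStd z))) : nonzeroIntegers C.k C.K) : C.K) = ((Λ (toStd z) : _) : AlgebraicClosure C.k)
  rw [htoStd_symm, AlgEquiv.apply_symm_apply]

/-- **THE Galois-equivariant lift `liftM(φ)` of `φ ∈ Aut_top(G_k)` PRESERVES `N_{k/ℚ_p}` on `𝒪_k^×`** — GAP-LEDGER row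
G-L6d2-1 verbatim (the binder `hN` of abc-iut-L6-d2's `AbsTopMonoids.rmk181_genuineOfModelIsm_of_normCompat`,
[IUTchII] Rmk. 1.8.1 proof, kurims p. 42 l. 1–6 «`Aut(G)`-equivariant»), for EVERY `C : MLFClosure`: from the
standard-closure case (`norm_liftM_eq_std`) by `algEquiv_coe_liftM` (`IsAlgClosure.equiv` is the identity on `k`).
Classical inputs: `ψ̄|_{k^×} = Art_k⁻¹ ∘ φ^{ab} ∘ Art_k` ([AbsAnab] Prop. 1.2.1 (iii)/(vii)), `χ_cyc ∘ φ = χ_cyc`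
(Prop. 1.2.1 (vi)), `χ_cyc ∘ Art_k = N_{k/ℚ_p}⁻¹` on `𝒪_k^×` (Serre). [cite: MochizukiAbsAnab2004, Prop 1.2.1 (vi) p.10] -/
theorem MLFClosure.norm_liftM_eq (C : MLFClosure.{0}) [Fact C.residueChar.Prime] :
    letI : Algebra ℚ_[C.residueChar] C.k := LocalField.padicAlgebra C.k C.residueChar C.valuation_ringChar_lt_one
    ∀ (φ : (ModelMLFGaloisData.galois C.k C.K).tmPair.Pi ≃ₜ* (ModelMLFGaloisData.galois C.k C.K).tmPair.Pi)
      (u u' : C.k) (hu : algebraMap C.k C.K u ∈ nonzeroIntegers C.k C.K), valuation C.k u = 1 →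
      ((Literature.IUT.HodgeArakelov.AbsTopMonoids.Genuine.liftM C φ ⟨algebraMap C.k C.K u, hu⟩ :
          nonzeroIntegers C.k C.K) : C.K) = algebraMap C.k C.K u' →
      Algebra.norm ℚ_[C.residueChar] u' = Algebra.norm ℚ_[C.residueChar] u := by
  intro φ u u' hu hv heq
  let ψ : C.K ≃ₐ[C.k] AlgebraicClosure C.k := IsAlgClosure.equiv C.k C.K (AlgebraicClosure C.k)
  have h0 := C.algEquiv_coe_liftM φ ⟨algebraMap C.k C.K u, hu⟩
  rw [heq, AlgEquiv.commutes] at h0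
  have hu₀ : algebraMap C.k (AlgebraicClosure C.k) u ∈ nonzeroIntegers C.k (AlgebraicClosure C.k) := by
    rw [← ψ.commutes u]
    exact (C.mem_nonzeroIntegers_algEquiv_iff ψ _).mpr hu
  have harg : (⟨IsAlgClosure.equiv C.k C.K (AlgebraicClosure C.k) (algebraMap C.k C.K u),
      (C.mem_nonzeroIntegers_algEquiv_iff _ _).mpr hu⟩ : nonzeroIntegers C.k (AlgebraicClosure C.k)) =
      ⟨algebraMap C.k (AlgebraicClosure C.k) u, hu₀⟩ := Subtype.ext (ψ.commutes u)
  rw [harg] at h0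
  exact MLFClosure.norm_liftM_eq_std C.k C.residueChar C.valuation_ringChar_lt_one _ u u' hu₀ hv h0.symm

end AnyClosure

end Literature.AnabelianGeometry.AbsoluteAnabelian

end
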